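import Summits.HodgeConjecture.HodgeConjecture.Theorems.HeckePrymWeilWeilTwelvefoldsSqrtMinus7CmCurveModel
import Summits.HodgeConjecture.HodgeConjecture.Theorems.HeckePrymWeilWeilTwelvefoldsSqrtMinus7CmSurfaceDescentPairGeneral
import HarnessLib

/-!
# The CM Weil surface with its descent pair and degree-one model, for every `d ≥ 1` (the PARTNER half of the product trick)

Crux `WeilTwelvefoldsSqrtMinus7` (stmt-HodgeConjecture-1261), line `amnesic-secant-sheaves-split-fourteenfolds`
(lead seat c1), registered sub-goal `exists_cmWeilSurface_descentPair`. The named fact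
`Motives.exists_cmWeilSurface_aimedSplitProduct_of_ne_one_of_ne_three` (the aiming lemma of the product trick,
Markman arXiv:2509.23403 §11.5 Step 2; van Geemen, LNM 1594, 5.2–5.4; Schoen 1998 §10) asserts, for
`d ∉ {1, 3}`, ONE Weil surface `(B, ψ)`, `ψ ≫ ψ = -d`, carrying a DESCENT PAIR (`b₊ ∈ Eig((𝟙+ψ)^*, (1+i√d)²)`,
`b₋ ∈ Eig((𝟙+ψ)^*, (1-i√d)²)`, `b₊ + b₋` rational of type `(1,1)`, `η` algebraic with `b± ⌣ η ≠ 0`) such that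
every Weil-type `A` aims against it. This file PROVES the existence of the partner with its descent pair for
EVERY `d ≥ 1`, together with the degree-one data the aiming half consumes: `B = E × E` for the CM curve
`E = ℂ/(ℤ + ℤ√-d)` with `φ = [√-d]` (`exists_cmCurveModel`: `dim E = 1`, `φ ≫ φ = -d`, rational basis `x` of `H¹`
with `φ^*`-matrix `(0 1; -d 0)`, additivity, `x₀ ⌣ x₁ ≠ 0` spanning `H²`) and `ψ = (φ, -φ)`
(`cmSurfaceDescentPair_general`). What remains of the named fact is the AIMING half alone (the line's stubs
α₁, α₂, β, γ and the Hodge–Riemann leaf).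
-/

noncomputable section

set_option linter.dupNamespace false

open CategoryTheory Complex
open Literature.AlgebraicGeometry Literature.AlgebraicGeometry.Motives
  Literature.AlgebraicGeometry.HodgeTheory Literature.AlgebraicTopology.SingularHomology

namespace Summit.HodgeConjecture.HodgeConjecture.Theorems.WeilTwelvefoldsSqrtMinus7.AmnesicSecantSheaves

/-- **The CM partner for `K = ℚ(√-d)`, every `d ≥ 1`: curve, model, surface, descent pair.** There are a
complex elliptic curve `E` (`dim E = 1`) with `φ ≫ φ = -d` and a rational basis `x₀, x₁` of `H¹(E(ℂ); ℂ)` with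
`φ^*`-matrix `M = (0 1; -d 0)`, additive pull-backs, `x₀ ⌣ x₁ ≠ 0` spanning `H²`, such that the surface
`B = E × E` with `ψ = (φ, -φ)` has `dim B = 2`, `ψ ≫ ψ = -d` and a descent pair `(b₊, b₋, η)` in the typing of
`Motives.exists_cmWeilSurface_aimedSplitProduct_of_ne_one_of_ne_three`. Witness: `E = ℂ/(ℤ + ℤ√-d)`,
`φ = [√-d]`. [cite: vanGeemen1994HodgeAV, Lemma 5.2 and 5.3] [cite: Schoen1998HodgeWeilAddendum, §10]
[cite: Markman2025SurveySecant, §11.5 Step 2] -/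
theorem exists_cmWeilSurface_descentPair (d : ℕ) (hd : 0 < d) :
    ∃ (E : AbelianVariety ℂ) (φ : E ⟶ E) (x : Fin 2 → complexBetti E.X 1),
      E.dim = 1 ∧ φ ≫ φ = -((d : ℤ) • 𝟙 E) ∧
      (∀ i, IsRationalClass (x i)) ∧ LinearIndependent ℂ x ∧ Submodule.span ℂ (Set.range x) = ⊤ ∧
      (∀ i, complexBetti.map φ.hom.hom.hom 1 (x i) =
        ∑ j, (((!![0, 1; -(d : ℤ), 0] : Matrix (Fin 2) (Fin 2) ℤ) j i : ℤ) : ℂ) • x j) ∧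
      (∀ (T : AbelianVariety ℂ) (f g : T ⟶ E) (i : Fin 2),
        complexBetti.map (f + g).hom.hom.hom 1 (x i) =
          complexBetti.map f.hom.hom.hom 1 (x i) + complexBetti.map g.hom.hom.hom 1 (x i)) ∧
      cupProduct (rfl : 1 + 1 = 2) (x 0) (x 1) ≠ 0 ∧
      (∀ c : complexBetti E.X 2, ∃ t : ℂ, c = t • cupProduct (rfl : 1 + 1 = 2) (x 0) (x 1)) ∧
      (E.prod E).dim = 2 ∧
      AbelianVariety.prodLift (AbelianVariety.fst E E ≫ φ) (AbelianVariety.snd E E ≫ (-φ)) ≫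
        AbelianVariety.prodLift (AbelianVariety.fst E E ≫ φ) (AbelianVariety.snd E E ≫ (-φ)) =
          -((d : ℤ) • 𝟙 (E.prod E)) ∧
      ∃ bp bm η : complexBetti (E.prod E).X 2,
        bp ∈ Module.End.eigenspace (complexBetti.map (𝟙 (E.prod E) +
              AbelianVariety.prodLift (AbelianVariety.fst E E ≫ φ) (AbelianVariety.snd E E ≫ (-φ))).hom.hom.hom 2).hom
              ((1 + Complex.I * (Real.sqrt (d : ℝ) : ℂ)) ^ 2) ∧
        bm ∈ Module.End.eigenspace (complexBetti.map (𝟙 (E.prod E) +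
              AbelianVariety.prodLift (AbelianVariety.fst E E ≫ φ) (AbelianVariety.snd E E ≫ (-φ))).hom.hom.hom 2).hom
              ((1 - Complex.I * (Real.sqrt (d : ℝ) : ℂ)) ^ 2) ∧
        IsRationalClass (bp + bm) ∧ IsOfHodgeType 2 (E.prod E).X 2 1 1 (bp + bm) ∧
        η ∈ algebraicClasses (E.prod E).X 1 ∧
        cupProduct (show 2 + 2 = 4 from rfl) bp η ≠ 0 ∧
        cupProduct (show 2 + 2 = 4 from rfl) bm η ≠ 0 := by
  obtain ⟨E, φ, x, hE, hφ, hxr, hxi, hxs, hM, hadd, hω, hH2⟩ := exists_cmCurveModel d hd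
  obtain ⟨hdim, hψ, hpair⟩ := cmSurfaceDescentPair_general d hd E φ hE hφ x _ hxr hxi hxs hM hadd hω hH2
  exact ⟨E, φ, x, hE, hφ, hxr, hxi, hxs, hM, hadd, hω, hH2, hdim, hψ, hpair⟩

end Summit.HodgeConjecture.HodgeConjecture.Theorems.WeilTwelvefoldsSqrtMinus7.AmnesicSecantSheaves

end
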